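import Mathlib.Analysis.InnerProductSpace.Projection.Submodule
import Mathlib.Analysis.InnerProductSpace.Adjoint
import Literature.NumberTheory.Automorphic.HilbertRepSchur
import HarnessLib

/-!
# Minimal idempotents attached to a vector of an irreducible unitary representation of a subgroup
(the operators `R(ξ_S)`, `R'(ξ'_S)` of Gelbart's proof of the Jacquet–Langlands correspondence,
*Automorphic forms on adele groups* (1975), §10, pp. 151–153, (10.11), without Haar measure)

Topic `NumberTheory/Automorphic`; theorems only (no definition, no named fact, no instance). Part
of the inline (D-0026) decomposition of the named fact
`Literature.NumberTheory.Automorphic.multiplicity_one_quaternionUnits` (Gelbart Thm. 10.10). The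
assembled form of that theorem in the tree,
`multiplicity_one_quaternionUnits_of_sliceComparison` (`QuaternionUnitsMultiplicityOneOfSliceComparison`),
consumes on each side an operator `E` with: `E` a self-adjoint idempotent commuting with the
commutant of the regular representation, commuting with the complementary group `G^S`, and
satisfying `E R(k) y = c(k) y` on `E`-fixed vectors for `k` in the ramified component `G_S`. In
Gelbart these are the integrated operators of the idempotents
`ξ_S = ⊗_{v ∈ S} d(π_v) conj ⟨π_v(g) u_v, u_v⟩` (normalised matrix coefficients; orthogonality
relations (10.11)), which presupposes integrable matrix coefficients (supercuspidal `π_v`) and is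
patched in Remark 10.7 for special `π_v`. This file constructs such an `E` for an **arbitrary**
topologically irreducible unitary representation `σ` of a group `K` mapped into `Γ` by a
homomorphism `j`, and a unit vector `u ∈ σ`, by Hilbert-space means only:

* `ContRepresentation.exists_minimalIdempotent` — let `U ≤ H` be the closed span of the vectors
  `T u`, `T : σ → R` a bounded intertwiner (`T σ(k) = R(j k) T`), and `E = P_U`. Then `E` is a
  self-adjoint idempotent; it commutes with every bounded operator commuting with `R(j K)` (such an
  operator and its adjoint map intertwiners to intertwiners, so `U` reduces it); for every
  intertwiner `T` and `w ∈ σ`, **`E (T w) = ⟪u, w⟫ T u`** (Schur's lemma,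
  `IsTopIrreducible.exists_apply_eq_smul_of_commute`: `T'^* T` is a scalar on `σ`, whence
  `T(u^⊥) ⟂ T' u`); and **`E R(j k) E = ⟪u, σ(k) u⟫ E`**.
* `ContRepresentation.exists_minimalIdempotent_spec` — the same in the shape of the hypotheses
  `hEᵢsa`, `hEᵢidem`, `hEᵢT`, `hEᵢG`, `hEᵢK` of
  `multiplicity_one_quaternionUnits_of_sliceComparison`, plus `E (T u) = T u` (non-degeneracy of
  `E` on every closed invariant subspace containing a copy of `σ`).

So the idempotent part of the comparison datum is reduced to the choice of the local types
(`σ_S`, `σ'_S` and unit vectors) and, for non-degeneracy on a given constituent `π'`, to the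
existence of a `G'_S`-intertwiner `σ'_S → π'` (for `G'_S` compact modulo the centre: Peter–Weyl),
none of which is treated here.

## References

* S. Gelbart, *Automorphic forms on adele groups*, Ann. of Math. Studies 83 (1975), §10,
  pp. 151–153, (10.11), Remark 10.7 [Gelbart1975].
* A. Deitmar, S. Echterhoff, *Principles of harmonic analysis*, 2nd ed. (2014), Lemma 6.1.7
  (Schur) [DeitmarEchterhoff2014].
-/

noncomputable section

open scoped InnerProductSpace ComplexConjugate
open Topology

namespace ContRepresentation

section MinimalIdempotent

variable {Γ K : Type*} [Group Γ] [Group K]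
  {H : Type*} [NormedAddCommGroup H] [InnerProductSpace ℂ H] [CompleteSpace H]
  {V : Type*} [NormedAddCommGroup V] [InnerProductSpace ℂ V] [CompleteSpace V]

/-- A closed subspace `U` stable under `A` and under `A^*` reduces `A`: the orthogonal projection
onto `U` commutes with `A` (restated from `HilbertRepTraceComparison`, to keep this file low in
the import graph). [folklore] -/
private theorem starProjection_apply_of_invariant' (U : Submodule ℂ H) [U.HasOrthogonalProjection]
    (A : H →L[ℂ] H) (hA : ∀ v ∈ U, A v ∈ U)
    (hA' : ∀ v ∈ U, ContinuousLinearMap.adjoint A v ∈ U) (v : H) :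
    U.starProjection (A v) = A (U.starProjection v) := by
  refine Submodule.eq_starProjection_of_mem_orthogonal' (hA _ (U.starProjection_apply_mem v))
    (z := A (v - U.starProjection v)) ?_ (by rw [← map_add, add_sub_cancel])
  rw [Submodule.mem_orthogonal]
  intro w hw
  rw [← ContinuousLinearMap.adjoint_inner_left]
  exact Submodule.inner_right_of_mem_orthogonal (hA' w hw) (U.sub_starProjection_mem_orthogonal v)

/-- **The minimal idempotent of a unitary representation attached to a vector of an irreducible
unitary representation of a subgroup.** Let `R` be a unitary representation of `Γ` on the
Hilbert space `H`, `j : K → Γ` a homomorphism, `σ` a topologically irreducible unitary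
representation of `K` on the Hilbert space `V`, and `u ∈ V` a unit vector. Let `U ≤ H` be the
closed span of the vectors `T u`, `T : V → H` running through the bounded intertwiners
(`T σ(k) = R(j k) T`), and `E = P_U` the orthogonal projection onto `U`. Then:
(i) `E` is a self-adjoint idempotent; (ii) `E` commutes with every bounded operator commuting
with `R(j K)` (so `E` lies in the von Neumann algebra generated by `R(j K)`, commutes with `R(γ)`
for `γ` centralising `j(K)`, and commutes with the commutant of `R(Γ)`); (iii) for every
intertwiner `T` and `w ∈ V`, `E (T w) = ⟪u, w⟫ T u` — by Schur's lemma `T'^* T` is a scalar, so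
`T (u^⊥) ⟂ T' u`; in particular `E (T u) = T u`, and `E ≠ 0` on every closed invariant subspace
containing a copy of `σ`; (iv) **`E R(j k) E = ⟪u, σ(k) u⟫ E`** for all `k ∈ K`. This is the
operator which Gelbart writes `R(ξ_S)`, `ξ_S = ⊗_{v ∈ S} d(π_v) \overline{⟨π_v(g) u_v, u_v⟩}`
(proof of Thm. 10.5, pp. 151–153: the projection onto `⊕_i {⊗_{v ∈ S} u_v} ⊗ {⊗_{v ∉ S} V^i_v}`,
orthogonality relations (10.11)), constructed here without Haar measure, formal degrees or
integrability of matrix coefficients, for an arbitrary irreducible unitary `σ` — so that it is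
available also when `π_v(π'_v)` is special (Remark 10.7). [cite: Gelbart1975, §10, pp. 151–153,
(10.11) and Remark 10.7; DeitmarEchterhoff2014, Lemma 6.1.7] -/
theorem exists_minimalIdempotent (R : ContRepresentation ℂ Γ H) (hR : R.IsUnitary) (j : K →* Γ)
    (σ : ContRepresentation ℂ K V) (hσ : σ.IsUnitary) (hσirr : σ.IsTopIrreducible)
    (u : V) (hu : ‖u‖ = 1) :
    ∃ E : H →L[ℂ] H,
      (∀ x y : H, ⟪E x, y⟫_ℂ = ⟪x, E y⟫_ℂ) ∧ (∀ x, E (E x) = E x) ∧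
      (∀ A : H →L[ℂ] H, (∀ k : K, A ∘L R (j k) = R (j k) ∘L A) → A ∘L E = E ∘L A) ∧
      (∀ (T : V →L[ℂ] H), (∀ k : K, T ∘L σ k = R (j k) ∘L T) →
        ∀ w : V, E (T w) = ⟪u, w⟫_ℂ • T u) ∧
      (∀ (k : K) (y : H), E (R (j k) (E y)) = ⟪u, σ k u⟫_ℂ • E y) := by
  -- intertwiners, the `u`-line space `U` and its projection
  set 𝒯 : Set (V →L[ℂ] H) := {T | ∀ k : K, T ∘L σ k = R (j k) ∘L T} with h𝒯
  set S₀ : Set H := {x | ∃ T ∈ 𝒯, x = T u} with hS₀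
  set U : Submodule ℂ H := (Submodule.span ℂ S₀).topologicalClosure with hUdef
  have hUc : IsClosed (U : Set H) := Submodule.isClosed_topologicalClosure _
  haveI : CompleteSpace U := hUc.completeSpace_coe
  have hS₀U : S₀ ⊆ (U : Set H) := fun x hx =>
    Submodule.le_topologicalClosure _ (Submodule.subset_span hx)
  have huu : ⟪u, u⟫_ℂ = 1 := by
    rw [inner_self_eq_norm_sq_to_K, hu]; norm_num
  -- adjoints of intertwiners intertwine back
  have hadjT : ∀ T ∈ 𝒯, ∀ k : K,
      ContinuousLinearMap.adjoint T ∘L R (j k) = σ k ∘L ContinuousLinearMap.adjoint T := by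
    intro T hT k
    have h := congrArg ContinuousLinearMap.adjoint (hT k⁻¹)
    rw [ContinuousLinearMap.adjoint_comp, ContinuousLinearMap.adjoint_comp, hσ.adjoint_apply,
      hR.adjoint_apply, map_inv j, inv_inv, inv_inv] at h
    exact h.symm
  -- Schur: `T'^* T` is a scalar, hence `T w' ⟂ T' u` for `w' ⟂ u`
  have horthT : ∀ T ∈ 𝒯, ∀ T' ∈ 𝒯, ∀ w' : V, ⟪u, w'⟫_ℂ = 0 → ⟪T' u, T w'⟫_ℂ = 0 := by
    intro T hT T' hT' w' hw'
    set D : V →L[ℂ] V := ContinuousLinearMap.adjoint T' ∘L T with hD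
    have hDcomm : ∀ k : K, Commute (σ k : V →L[ℂ] V) D := by
      intro k
      change σ k * D = D * σ k
      rw [hD, ContinuousLinearMap.mul_def, ContinuousLinearMap.mul_def,
        ← ContinuousLinearMap.comp_assoc, ← hadjT T' hT' k, ContinuousLinearMap.comp_assoc,
        ← hT k, ContinuousLinearMap.comp_assoc]
    obtain ⟨c, hc⟩ := hσirr.exists_apply_eq_smul_of_commute hσ hDcomm
    rw [← ContinuousLinearMap.adjoint_inner_right, ← ContinuousLinearMap.comp_apply, ← hD, hc,
      inner_smul_right, hw', mul_zero]
  -- (iii) `E (T w) = ⟪u, w⟫ T u`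
  have hiii : ∀ T ∈ 𝒯, ∀ w : V, U.starProjection (T w) = ⟪u, w⟫_ℂ • T u := by
    intro T hT w
    set w' : V := w - ⟪u, w⟫_ℂ • u with hw'
    have hw'u : ⟪u, w'⟫_ℂ = 0 := by
      rw [hw', inner_sub_right, inner_smul_right, huu, mul_one, sub_self]
    have hdecomp : T w = ⟪u, w⟫_ℂ • T u + T w' := by
      rw [hw', map_sub, map_smul, add_sub_cancel]
    have hTu : U.starProjection (T u) = T u :=
      Submodule.starProjection_eq_self_iff.mpr (hS₀U ⟨T, hT, rfl⟩)
    have hTw' : U.starProjection (T w') = 0 := by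
      rw [Submodule.starProjection_apply_eq_zero_iff]
      -- `T w' ∈ Uᗮ`: `U ≤ (ℂ ∙ T w')ᗮ`
      have hle : U ≤ (ℂ ∙ T w')ᗮ := by
        refine (Submodule.span ℂ S₀).topologicalClosure_minimal ?_ (Submodule.isClosed_orthogonal _)
        rw [Submodule.span_le]
        rintro _ ⟨T', hT', rfl⟩
        rw [SetLike.mem_coe, Submodule.mem_orthogonal_singleton_iff_inner_left]
        exact horthT T hT T' hT' w' hw'u
      rw [Submodule.mem_orthogonal]
      intro x hx
      have hx' := hle hx
      rw [Submodule.mem_orthogonal_singleton_iff_inner_left] at hx'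
      exact hx'
    rw [hdecomp, map_add, map_smul, hTu, hTw', add_zero]
  -- (ii) operators commuting with `R(j K)` reduce `U`
  have hii : ∀ A : H →L[ℂ] H, (∀ k : K, A ∘L R (j k) = R (j k) ∘L A) →
      A ∘L U.starProjection = U.starProjection ∘L A := by
    intro A hA
    -- `A` and `A^*` commute with `R(j K)`
    have hA' : ∀ k : K, ContinuousLinearMap.adjoint A ∘L R (j k) =
        R (j k) ∘L ContinuousLinearMap.adjoint A := by
      intro k
      have h := congrArg ContinuousLinearMap.adjoint (hA k⁻¹)
      rw [ContinuousLinearMap.adjoint_comp, ContinuousLinearMap.adjoint_comp, hR.adjoint_apply,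
        map_inv j, inv_inv] at h
      exact h.symm
    -- both map `U` into `U`
    have hmapsU : ∀ C : H →L[ℂ] H, (∀ k : K, C ∘L R (j k) = R (j k) ∘L C) → ∀ v ∈ U, C v ∈ U := by
      intro C hC
      have hCS₀ : ∀ x ∈ S₀, C x ∈ S₀ := by
        rintro _ ⟨T, hT, rfl⟩
        refine ⟨C ∘L T, fun k => ?_, rfl⟩
        rw [ContinuousLinearMap.comp_assoc, hT k, ← ContinuousLinearMap.comp_assoc, hC k,
          ContinuousLinearMap.comp_assoc]
      have hCspan : ∀ x ∈ Submodule.span ℂ S₀, C x ∈ Submodule.span ℂ S₀ := by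
        intro x hx
        have h : (Submodule.span ℂ S₀).map (C : H →ₗ[ℂ] H) ≤ Submodule.span ℂ S₀ := by
          rw [Submodule.map_span]
          refine Submodule.span_mono ?_
          rintro _ ⟨y, hy, rfl⟩
          exact hCS₀ y hy
        exact h ⟨x, hx, rfl⟩
      intro v hv
      have hmaps : Set.MapsTo C (Submodule.span ℂ S₀ : Set H) (Submodule.span ℂ S₀ : Set H) :=
        fun y hy => hCspan y hy
      have hcl := hmaps.closure C.continuous
      rw [← Submodule.topologicalClosure_coe] at hcl
      exact hcl hv
    apply ContinuousLinearMap.ext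
    intro v
    simp only [ContinuousLinearMap.coe_comp, Function.comp_apply]
    exact (starProjection_apply_of_invariant' U A (hmapsU A hA) (hmapsU _ hA') v).symm
  -- (iv) `E R(j k) E = ⟪u, σ k u⟫ E`
  have hiv : ∀ (k : K) (y : H), U.starProjection (R (j k) (U.starProjection y)) =
      ⟪u, σ k u⟫_ℂ • U.starProjection y := by
    intro k y
    -- the bounded operator `x ↦ E (R(j k) x) - c • x` vanishes on `S₀`, hence on `U`
    set Φ : H →L[ℂ] H := U.starProjection ∘L R (j k) - ⟪u, σ k u⟫_ℂ • ContinuousLinearMap.id ℂ H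
      with hΦ
    have hΦapply : ∀ x, Φ x = U.starProjection (R (j k) x) - ⟪u, σ k u⟫_ℂ • x := fun x => rfl
    have hΦS₀ : ∀ x ∈ S₀, Φ x = 0 := by
      rintro _ ⟨T, hT, rfl⟩
      have h1 : R (j k) (T u) = T (σ k u) := by
        rw [← ContinuousLinearMap.comp_apply, ← hT k, ContinuousLinearMap.comp_apply]
      rw [hΦapply, h1, hiii T hT (σ k u), sub_self]
    have hΦU : ∀ x ∈ U, Φ x = 0 := by
      intro x hx
      have hle : U ≤ LinearMap.ker (Φ : H →ₗ[ℂ] H) := by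
        refine (Submodule.span ℂ S₀).topologicalClosure_minimal ?_ (Φ.isClosed_ker)
        rw [Submodule.span_le]
        intro x hx
        exact hΦS₀ x hx
      exact hle hx
    have h := hΦU _ (U.starProjection_apply_mem y)
    rw [hΦapply, sub_eq_zero] at h
    exact h
  refine ⟨U.starProjection, fun x y => Submodule.inner_starProjection_left_eq_right U x y,
    fun x => ?_, fun A hA => hii A hA, fun T hT w => hiii T hT w, hiv⟩
  exact Submodule.starProjection_eq_self_iff.mpr (U.starProjection_apply_mem x)

/-- **The minimal idempotent, in the form consumed by the trace comparison**
(`Literature.NumberTheory.Automorphic.multiplicity_one_quaternionUnits_of_sliceComparison`,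
hypotheses `hE₁sa`, `hE₁idem`, `hE₁T`, `hE₁G`, `hE₁K` / `hE₂…`): for a unitary representation `R`
of `Γ`, a homomorphism `j : K → Γ`, an irreducible unitary `σ` of `K` and a unit vector `u`, there
is a self-adjoint idempotent `E` on `H` commuting with the commutant of `R(Γ)`, commuting with
`R(γ)` for every `γ` centralising `j(K)`, acting by `E R(j k) y = ⟪u, σ(k) u⟫ y` on `E`-fixed
vectors, and fixing `T u` for every intertwiner `T : σ → R` (non-degeneracy on every closed
invariant subspace containing a copy of `σ`). Gelbart's `R(ξ_S)` and `R'(ξ'_S)` (pp. 151–153) are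
such operators for `K = G_S`, `G'_S` and the local types `σ_S = ⊗_{v ∈ S} π_v(π'_v)`,
`σ'_S = ⊗_{v ∈ S} π'_v`. [cite: Gelbart1975, §10, pp. 151–153 and (10.11)] -/
theorem exists_minimalIdempotent_spec (R : ContRepresentation ℂ Γ H) (hR : R.IsUnitary)
    (j : K →* Γ) (σ : ContRepresentation ℂ K V) (hσ : σ.IsUnitary) (hσirr : σ.IsTopIrreducible)
    (u : V) (hu : ‖u‖ = 1) :
    ∃ E : H →L[ℂ] H,
      (∀ x y : H, ⟪E x, y⟫_ℂ = ⟪x, E y⟫_ℂ) ∧ (∀ x, E (E x) = E x) ∧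
      (∀ A : H →L[ℂ] H, (∀ γ : Γ, A ∘L R γ = R γ ∘L A) → A ∘L E = E ∘L A) ∧
      (∀ γ : Γ, (∀ k : K, γ * j k = j k * γ) → ∀ y, E (R γ y) = R γ (E y)) ∧
      (∀ (k : K) (y : H), E y = y → E (R (j k) y) = ⟪u, σ k u⟫_ℂ • y) ∧
      (∀ (T : V →L[ℂ] H), (∀ k : K, T ∘L σ k = R (j k) ∘L T) → E (T u) = T u) := by
  obtain ⟨E, hsa, hidem, hcomm, hT, hK⟩ := exists_minimalIdempotent R hR j σ hσ hσirr u hu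
  refine ⟨E, hsa, hidem, fun A hA => hcomm A fun k => hA (j k), fun γ hγ y => ?_, fun k y hy => ?_,
    fun T hT' => ?_⟩
  · have h : R γ ∘L E = E ∘L R γ := hcomm (R γ) fun k => by
      rw [← ContinuousLinearMap.mul_def, ← ContinuousLinearMap.mul_def, ← map_mul, ← map_mul, hγ k]
    have := DFunLike.congr_fun h y
    simpa only [ContinuousLinearMap.coe_comp, Function.comp_apply] using this.symm
  · have h := hK k y
    rw [hy] at h
    exact h
  · have huu : ⟪u, u⟫_ℂ = 1 := by
      rw [inner_self_eq_norm_sq_to_K, hu]; norm_num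
    rw [hT T hT' u, huu, one_smul]

end MinimalIdempotent

end ContRepresentation
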